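import Summits.AtomisticToContinuum.FouriersLaw.Theorems.HiddenChargeMazurOddChargeAlgebraToolkitC

/-!
# Odd conservation laws of the pinned anharmonic chain — the end coefficients

File `Ends` of the NEGATIVE edge of crux `HiddenChargeMazur.OddChargeExists`
(item stmt-AtomisticToContinuum-13511).  For a leading p-linear member of span `D ≥ 1` the
boundary equation `bup D F = 0` reads `(α) cub(q_{D+1},q_D)·a_D + cub(q_0,q_1)·S(a_0) = 0` and the
strain equation gives `(H2) ∂_{q_0} a_D + ∂_{q_D} a_0 = 0`; together they force the closed forms
`a_0 = c·lead0 D`, `a_D = c·leadD D` (`ends_closed_form`).  The two ingredients are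

* `two_ended_factor` — `cub(q_0,q_1)·X = cub(q_{D+1},q_D)·Y` with `X` free of `q_0` and `Y` free
  of `q_{D+1}` forces `X = cub(q_{D+1},q_D)·T`, `Y = cub(q_0,q_1)·T` (the `∂³` trick:
  `∂_{q_0}³ cub(q_0,q_1) = 6`);
* `nu_form` — the functional equation `γ_{D-1}² ν = γ_0² S ν` forces `ν = c·∏_{j<D-1} γ_j²`
  (iteration along the kernel `(γ_k)` of the substitution `q_k ↦ q_{k+1}`; a shift-invariant
  polynomial is constant).

Everything is elementary commutative algebra in `𝓡 = ℝ[q_x, p_x : x ∈ ℤ]`. [folklore]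
-/

noncomputable section

open MvPolynomial
open scoped BigOperators

namespace Summit.AtomisticToContinuum.FouriersLaw.Theorems.OddChargeAlgebra

/-! ### Private toolkit: constants, `cub`, `gam` -/

/-- `C (1/6) · 6 = 1` in `𝓡`. [folklore] -/
private theorem C_sixth_mul_six' : (C (1 / 6 : ℝ) : R) * 6 = 1 := by
  rw [← map_ofNat C 6, ← C_mul]
  norm_num

/-- Numerals are killed by every partial derivative. [folklore] -/
private theorem pderiv_ofNat' (v : Var) (n : ℕ) [n.AtLeastTwo] :
    pderiv v (ofNat(n) : R) = 0 := by
  rw [← map_ofNat C n]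
  exact pderiv_C

/-- Leibniz with a `v`-free right factor. [folklore] -/
private theorem pderiv_mul_of_right' {v : Var} {P : R} (hP : pderiv v P = 0) (E : R) :
    pderiv v (E * P) = pderiv v E * P := by
  rw [pderiv_mul, hP, mul_zero, add_zero]

/-- Leibniz with a `v`-free left factor. [folklore] -/
private theorem pderiv_mul_of_left' {v : Var} {E : R} (hE : pderiv v E = 0) (P : R) :
    pderiv v (E * P) = E * pderiv v P := by
  rw [pderiv_mul, hE, zero_mul, zero_add]

/-- `∂_v cub(X v, X w) = 3 (X v - X w)²` for `w ≠ v`. [folklore] -/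
private theorem pderiv_cub_self' {v w : Var} (hw : w ≠ v) :
    pderiv v (cub (X v) (X w)) = 3 * (X v - X w) ^ 2 := by
  simp only [cub, map_sub, map_add, pderiv_mul, pderiv_pow, pderiv_X_self, pderiv_X_of_ne hw,
    pderiv_ofNat']
  ring

/-- `cub(X a, X b)` is free of every other variable. [folklore] -/
private theorem pderiv_cub_of_ne' {v a b : Var} (ha : a ≠ v) (hb : b ≠ v) :
    pderiv v (cub (X a) (X b)) = 0 := by
  simp only [cub, map_sub, map_add, pderiv_mul, pderiv_pow, pderiv_X_of_ne ha,
    pderiv_X_of_ne hb, pderiv_ofNat']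
  ring

/-- The `∂³` trick: `∂_v³ (cub(X v, X w) · P) = 6 P` for a `v`-free `P`. [folklore] -/
private theorem pderiv3_cub_mul' {v w : Var} (hw : w ≠ v) {P : R} (hP : pderiv v P = 0) :
    pderiv v (pderiv v (pderiv v (cub (X v) (X w) * P))) = 6 * P := by
  have d2 : pderiv v (3 * (X v - X w) ^ 2 : R) = 6 * (X v - X w) := by
    simp only [map_sub, pderiv_mul, pderiv_pow, pderiv_X_self, pderiv_X_of_ne hw, pderiv_ofNat']
    ring
  have d3 : pderiv v (6 * (X v - X w) : R) = 6 := by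
    simp only [map_sub, pderiv_mul, pderiv_X_self, pderiv_X_of_ne hw, pderiv_ofNat']
    ring
  rw [pderiv_mul_of_right' hP, pderiv_cub_self' hw, pderiv_mul_of_right' hP, d2,
    pderiv_mul_of_right' hP, d3]

/-- `cub(X a, X b) ≠ 0` (its value at the all-ones point is `1`). [folklore] -/
private theorem cub_X_ne_zero' (a b : Var) : cub (X a) (X b) ≠ 0 := by
  intro h
  have := congrArg (eval fun _ => (1 : ℝ)) h
  simp only [cub, map_sub, map_add, map_mul, map_pow, eval_X, map_ofNat, map_zero] at this
  norm_num at this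

/-! ### Private toolkit: supports -/

/-- Constants are supported everywhere. [folklore] -/
private theorem C_mem_supported' (s : Set Var) (c : ℝ) : (C c : R) ∈ supported ℝ s := by
  rw [← MvPolynomial.algebraMap_eq]
  exact Subalgebra.algebraMap_mem _ c

/-- Partial derivatives do not enlarge the support. [folklore] -/
private theorem pderiv_mem_supported' {s : Set Var} (v : Var) {p : R} (hp : p ∈ supported ℝ s) :
    pderiv v p ∈ supported ℝ s := by
  rw [supported_eq_adjoin_X] at hp
  refine Algebra.adjoin_induction (p := fun x _ => pderiv v x ∈ supported ℝ s) ?_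
    (fun r => by rw [Derivation.map_algebraMap]; exact zero_mem _)
    (fun x y _ _ hx hy => by rw [map_add]; exact add_mem hx hy)
    (fun x y hx' hy' hx hy => by
      rw [pderiv_mul]; exact add_mem (mul_mem hx hy') (mul_mem hx' hy)) hp
  rintro x ⟨w, -, rfl⟩
  rcases eq_or_ne w v with rfl | h
  · rw [pderiv_X_self]
    exact one_mem _
  · rw [pderiv_X_of_ne h]
    exact zero_mem _

/-- A polynomial is free of every variable outside its support. [folklore] -/
private theorem pderiv_eq_zero_of_supported' {s : Set Var} {v : Var} {f : R} (hv : v ∉ s)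
    (hf : f ∈ supported ℝ s) : pderiv v f = 0 :=
  pderiv_eq_zero_of_notMem_vars fun h =>
    hv (MvPolynomial.mem_supported.1 hf (Finset.mem_coe.2 h))

/-! ### Private toolkit: the shift -/

/-- Translations of the variables are injective. [folklore] -/
private theorem transl_injective' (k : ℤ) : Function.Injective (transl k) := by
  intro a b h
  cases a <;> cases b <;> simp_all [transl]

/-- The site of a translated variable. [folklore] -/
private theorem site_transl' (k : ℤ) (u : Var) : Var.site (transl k u) = Var.site u + k := by
  cases u <;> simp [Var.site, transl]

/-- The shift is injective. [folklore] -/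
private theorem shift_injective' : Function.Injective shift := fun _ _ h =>
  rename_injective (transl 1) (transl_injective' 1) h

/-- The shift on position variables. [folklore] -/
private theorem shift_X_inl' (x : ℤ) : shift (X (Sum.inl x) : R) = X (Sum.inl (x + 1)) := by
  simp [shift, shiftBy, transl]

/-- `S γ_j = γ_{j+1}`. [folklore] -/
private theorem shift_gam'' (j : ℤ) : shift (gam j) = gam (j + 1) := by
  simp only [gam, map_sub, shift_X_inl']

/-- `S (∏_{j ∈ [a,b)} γ_j²) = ∏_{j ∈ [a+1,b+1)} γ_j²`. [folklore] -/
private theorem shift_prodsq_Ico'' (a b : ℤ) :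
    shift (prodsq (Finset.Ico a b)) = prodsq (Finset.Ico (a + 1) (b + 1)) := by
  simp only [prodsq, map_prod, map_pow, shift_gam'']
  rw [← Finset.map_add_right_Ico, Finset.prod_map]
  rfl

/-- `S ∘ S⁻¹ = id`. [folklore] -/
private theorem shift_shiftBy_neg_one' (f : R) : shift (shiftBy (-1) f) = f := by
  have h : (transl 1 ∘ transl (-1) : Var → Var) = id := by
    funext v
    cases v <;> simp [transl]
  simp only [shift, shiftBy, rename_rename, h, rename_id_apply]

/-- `∂_{q_{x+1}} ∘ S = S ∘ ∂_{q_x}`. [folklore] -/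
private theorem pderiv_inl_succ_shift' (x : ℤ) (f : R) :
    pderiv (Sum.inl (x + 1)) (shift f) = shift (pderiv (Sum.inl x) f) :=
  pderiv_rename (transl_injective' 1) (Sum.inl x) f

/-- The shift moves supports one site to the right. [folklore] -/
private theorem shift_mem_supported' {a b : ℤ} {f : R}
    (hf : f ∈ supported ℝ (Var.site ⁻¹' Set.Icc a b)) :
    shift f ∈ supported ℝ (Var.site ⁻¹' Set.Icc (a + 1) (b + 1)) := by
  rw [MvPolynomial.mem_supported] at hf ⊢
  intro w hw
  obtain ⟨u, hu, rfl⟩ := mem_vars_rename (transl 1) f (Finset.mem_coe.1 hw)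
  have := hf (Finset.mem_coe.2 hu)
  simp only [Set.mem_preimage, Set.mem_Icc, site_transl'] at this ⊢
  omega

/-- A shift-invariant polynomial is a constant (look at a variable of minimal site). [folklore] -/
private theorem exists_C_of_shift_eq' {f : R} (h : shift f = f) : ∃ c : ℝ, f = C c := by
  classical
  by_cases hv : f.vars = ∅
  · exact ⟨f.coeff 0, vars_eq_empty_iff_eq_C.1 hv⟩
  obtain ⟨w, hw, hmin⟩ :=
    Finset.exists_min_image f.vars Var.site (Finset.nonempty_of_ne_empty hv)
  rw [← h] at hw
  obtain ⟨u, hu, rfl⟩ := mem_vars_rename (transl 1) f hw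
  have := hmin u hu
  rw [site_transl'] at this
  omega

/-! ### The `(◆)` iteration -/

/-- One step of the `(◆)` iteration: `γ_{D-1}² μ = γ_k² S μ` with `k ≤ D-2` forces
`μ = γ_k² μ'` with `γ_{D-1}² μ' = γ_{k+1}² S μ'` (divide twice by `γ_k`). [folklore] -/
private theorem nu_step' {D k : ℤ} (hk : k + 1 ≤ D - 1) {μ : R}
    (h : gam (D - 1) ^ 2 * μ = gam k ^ 2 * shift μ) :
    ∃ μ' : R, μ = gam k ^ 2 * μ' ∧ gam (D - 1) ^ 2 * μ' = gam (k + 1) ^ 2 * shift μ' := by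
  have hfg : fuse k (gam (D - 1)) = gam (D - 1) := fuse_gam_of_ne (by omega) (by omega)
  have hg0 : gam (D - 1) ^ 2 ≠ 0 := pow_ne_zero _ (gam_ne_zero _)
  have hgk : gam k ≠ 0 := gam_ne_zero _
  have h1 : fuse k μ = 0 := by
    have e := congrArg (fuse k) h
    simp only [map_mul, map_pow, hfg, fuse_gam_self, zero_pow two_ne_zero, zero_mul] at e
    exact (mul_eq_zero.1 e).resolve_left hg0
  obtain ⟨μ₁, rfl⟩ := exists_eq_gam_mul_of_fuse_eq_zero k μ h1
  have h2 : gam (D - 1) ^ 2 * μ₁ = gam k * gam (k + 1) * shift μ₁ := by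
    apply mul_left_cancel₀ hgk
    rw [map_mul, shift_gam''] at h
    linear_combination h
  have h3 : fuse k μ₁ = 0 := by
    have e := congrArg (fuse k) h2
    simp only [map_mul, map_pow, hfg, fuse_gam_self, zero_mul] at e
    exact (mul_eq_zero.1 e).resolve_left hg0
  obtain ⟨μ₂, rfl⟩ := exists_eq_gam_mul_of_fuse_eq_zero k μ₁ h3
  refine ⟨μ₂, by ring, mul_left_cancel₀ hgk ?_⟩
  rw [map_mul, shift_gam''] at h2
  linear_combination h2

/-! ### The three headline facts -/

/-- TWO-ENDED FACTORISATION (the `∂³` trick).  If `cub(q_0,q_1)·X = cub(q_{D+1},q_D)·Y` with `X`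
free of `q_0` and `Y` free of `q_{D+1}` (`D ≥ 1`), then `X = cub(q_{D+1},q_D)·T` and
`Y = cub(q_0,q_1)·T` for a `T` free of `q_0` and `q_{D+1}` whose variables are common to `X` and
`Y` (namely `T = ⅙ ∂_{q_0}³ Y = ⅙ ∂_{q_{D+1}}³ X`). [folklore] -/
theorem two_ended_factor : ∀ {D : ℤ}, 1 ≤ D → ∀ {Xp Yp : R} {SX SY : Set Var},
    Xp ∈ supported ℝ SX → Yp ∈ supported ℝ SY → pderiv (Sum.inl 0) Xp = 0 →
    pderiv (Sum.inl (D + 1)) Yp = 0 →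
    cub (X (Sum.inl 0)) (X (Sum.inl 1)) * Xp = cub (X (Sum.inl (D + 1))) (X (Sum.inl D)) * Yp →
    ∃ T : R, T ∈ supported ℝ (SX ∩ SY) ∧ pderiv (Sum.inl 0) T = 0 ∧
      pderiv (Sum.inl (D + 1)) T = 0 ∧ Xp = cub (X (Sum.inl (D + 1))) (X (Sum.inl D)) * T ∧
      Yp = cub (X (Sum.inl 0)) (X (Sum.inl 1)) * T := by
  intro D hD Xp Yp SX SY hX hY hX0 hY0 h
  have hne1 : (Sum.inl 1 : Var) ≠ Sum.inl 0 := by simp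
  have hneD : (Sum.inl D : Var) ≠ Sum.inl (D + 1) := by simp
  have hR0 : pderiv (Sum.inl 0) (cub (X (Sum.inl (D + 1))) (X (Sum.inl D))) = 0 :=
    pderiv_cub_of_ne' (by simp; omega) (by simp; omega)
  have hL1 : pderiv (Sum.inl (D + 1)) (cub (X (Sum.inl 0)) (X (Sum.inl 1))) = 0 :=
    pderiv_cub_of_ne' (by simp; omega) (by simp; omega)
  have hΦR : cub (X (Sum.inl (D + 1))) (X (Sum.inl D)) ≠ 0 := cub_X_ne_zero' _ _
  -- apply `∂_{q_0}³` to the factorisation: `6 X = cub(q_{D+1},q_D) ∂_{q_0}³ Y`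
  have e1 := congrArg (fun F => pderiv (Sum.inl 0) (pderiv (Sum.inl 0) (pderiv (Sum.inl 0) F))) h
  rw [pderiv3_cub_mul' hne1 hX0, pderiv_mul_of_left' hR0, pderiv_mul_of_left' hR0,
    pderiv_mul_of_left' hR0] at e1
  set T : R := C (1 / 6 : ℝ) * pderiv (Sum.inl 0) (pderiv (Sum.inl 0) (pderiv (Sum.inl 0) Yp))
    with hT
  have hXT : Xp = cub (X (Sum.inl (D + 1))) (X (Sum.inl D)) * T := by
    calc Xp = C (1 / 6 : ℝ) * (6 * Xp) := by rw [← mul_assoc, C_sixth_mul_six', one_mul]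
      _ = _ := by rw [e1, hT]; ring
  have hYT : Yp = cub (X (Sum.inl 0)) (X (Sum.inl 1)) * T := by
    apply mul_left_cancel₀ hΦR
    rw [← h, hXT]
    ring
  have hT0 : pderiv (Sum.inl 0) T = 0 := by
    rw [hXT, pderiv_mul_of_left' hR0] at hX0
    exact (mul_eq_zero.1 hX0).resolve_left hΦR
  have hT1 : pderiv (Sum.inl (D + 1)) T = 0 := by
    rw [hYT, pderiv_mul_of_left' hL1] at hY0
    exact (mul_eq_zero.1 hY0).resolve_left (cub_X_ne_zero' _ _)
  -- the symmetric expression `T = ⅙ ∂_{q_{D+1}}³ X` gives the support in `SX`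
  have hTX : T = C (1 / 6 : ℝ) *
      pderiv (Sum.inl (D + 1)) (pderiv (Sum.inl (D + 1)) (pderiv (Sum.inl (D + 1)) Xp)) := by
    rw [hXT, pderiv3_cub_mul' hneD hT1, ← mul_assoc, C_sixth_mul_six', one_mul]
  refine ⟨T, ?_, hT0, hT1, hXT, hYT⟩
  rw [MvPolynomial.mem_supported, Set.subset_inter_iff, ← MvPolynomial.mem_supported,
    ← MvPolynomial.mem_supported]
  constructor
  · rw [hTX]
    exact mul_mem (C_mem_supported' _ _)
      (pderiv_mem_supported' _ (pderiv_mem_supported' _ (pderiv_mem_supported' _ hX)))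
  · rw [hT]
    exact mul_mem (C_mem_supported' _ _)
      (pderiv_mem_supported' _ (pderiv_mem_supported' _ (pderiv_mem_supported' _ hY)))

/-- NU-FORM (the `(◆)` iteration).  For `D ≥ 1`, the functional equation `γ_{D-1}² ν = γ_0² S ν`
forces `ν = c · ∏_{0 ≤ j < D-1} γ_j²` for a constant `c`: iterate `nu_step'` along `k`, and finish
with "shift-invariant ⇒ constant". [folklore] -/
theorem nu_form : ∀ {D : ℤ}, 1 ≤ D → ∀ (ν : R), gam (D - 1) ^ 2 * ν = gam 0 ^ 2 * shift ν →
    ∃ c : ℝ, ν = C c * prodsq (Finset.Ico 0 (D - 1)) := by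
  intro D hD ν hν
  have key : ∀ n : ℕ, (n : ℤ) ≤ D - 1 → ∃ μ : R, ν = prodsq (Finset.Ico 0 (n : ℤ)) * μ ∧
      gam (D - 1) ^ 2 * μ = gam n ^ 2 * shift μ := by
    intro n
    induction n with
    | zero => exact fun _ => ⟨ν, by simp [prodsq], by simpa using hν⟩
    | succ n ih =>
      intro hn
      push_cast at hn ⊢
      obtain ⟨μ, hνμ, hμ⟩ := ih (by omega)
      obtain ⟨μ', hμμ', hμ'⟩ := nu_step' hn hμ
      refine ⟨μ', ?_, hμ'⟩
      rw [prodsq_Ico_succ (by positivity), hνμ, hμμ']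
      ring
  obtain ⟨μ, hνμ, hμ⟩ := key (D - 1).toNat (by omega)
  rw [Int.toNat_of_nonneg (by omega)] at hνμ hμ
  obtain ⟨c, hc⟩ :=
    exists_C_of_shift_eq' (mul_left_cancel₀ (pow_ne_zero 2 (gam_ne_zero _)) hμ).symm
  exact ⟨c, by rw [hνμ, hc, mul_comm]⟩

/-- ENDS.  For the end coefficients `a_0, a_D` (supported on sites `0..D`, `D ≥ 1`) of a leading
p-linear member, the boundary equation `(α) cub(q_{D+1},q_D)·a_D + cub(q_0,q_1)·S a_0 = 0` and the
strain equation `(H2) ∂_{q_0} a_D + ∂_{q_D} a_0 = 0` force `a_0 = c·lead0 D`, `a_D = c·leadD D`: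
two-ended factorisation gives `a_0 = cub(q_D,q_{D-1})·ν`, `a_D = -cub(q_0,q_1)·S ν`; then `(H2)`
is `3(γ_{D-1}² ν - γ_0² S ν) = 0`, and `nu_form` applies. [folklore] -/
theorem ends_closed_form : ∀ {D : ℤ}, 1 ≤ D → ∀ {a0 aD : R},
    a0 ∈ supported ℝ (Var.site ⁻¹' Set.Icc (0 : ℤ) D) →
    aD ∈ supported ℝ (Var.site ⁻¹' Set.Icc (0 : ℤ) D) →
    cub (X (Sum.inl (D + 1))) (X (Sum.inl D)) * aD
      + cub (X (Sum.inl 0)) (X (Sum.inl 1)) * shift a0 = 0 →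
    pderiv (Sum.inl 0) aD + pderiv (Sum.inl D) a0 = 0 →
    ∃ c : ℝ, a0 = C c * lead0 D ∧ aD = C c * leadD D := by
  intro D hD a0 aD ha0 haD hα h2
  have hSa0 : shift a0 ∈ supported ℝ (Var.site ⁻¹' Set.Icc (1 : ℤ) (D + 1)) := by
    simpa using shift_mem_supported' ha0
  have hX0 : pderiv (Sum.inl 0) (shift a0) = 0 :=
    pderiv_eq_zero_of_supported' (by simp [Var.site]) hSa0
  have hY0 : pderiv (Sum.inl (D + 1)) (-aD) = 0 := by
    rw [map_neg, pderiv_eq_zero_of_supported' (by simp [Var.site]) haD, neg_zero]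
  obtain ⟨T, -, hT0, hT1, hXT, hYT⟩ :=
    two_ended_factor hD hSa0 (neg_mem haD) hX0 hY0 (by linear_combination hα)
  -- `ν := S⁻¹ T`, so that `a_0 = cub(q_D,q_{D-1})·ν` and `a_D = -cub(q_0,q_1)·S ν`
  set ν : R := shiftBy (-1) T with hν
  have hshν : shift ν = T := shift_shiftBy_neg_one' T
  have ha0' : a0 = cub (X (Sum.inl D)) (X (Sum.inl (D - 1))) * ν := by
    apply shift_injective'
    rw [hXT, map_mul, hshν]
    congr 1
    simp only [cub, map_sub, map_add, map_mul, map_pow, map_ofNat, shift_X_inl', sub_add_cancel]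
  have haD' : aD = -(cub (X (Sum.inl 0)) (X (Sum.inl 1)) * T) := by rw [← hYT, neg_neg]
  have hνD : pderiv (Sum.inl D) ν = 0 := by
    apply shift_injective'
    rw [map_zero, ← pderiv_inl_succ_shift', hshν, hT1]
  -- the strain equation becomes `(◆)`
  have hne1 : (Sum.inl 1 : Var) ≠ Sum.inl 0 := by simp
  have hneD : (Sum.inl (D - 1) : Var) ≠ Sum.inl D := by simp
  have hdiamond : gam (D - 1) ^ 2 * ν = gam 0 ^ 2 * shift ν := by
    rw [haD', ha0', map_neg, pderiv_mul, pderiv_mul, hT0, hνD, pderiv_cub_self' hne1,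
      pderiv_cub_self' hneD] at h2
    have e3 : (3 : R) * ((X (Sum.inl (D - 1)) - X (Sum.inl D)) ^ 2 * ν
        - (X (Sum.inl 0) - X (Sum.inl 1)) ^ 2 * T) = 0 := by
      linear_combination h2
    have h3 : (3 : R) ≠ 0 := by
      rw [← map_ofNat C 3, Ne, C_eq_zero]
      norm_num
    simp only [gam, sub_add_cancel, zero_add, hshν]
    exact sub_eq_zero.1 ((mul_eq_zero.1 e3).resolve_left h3)
  obtain ⟨c, hc⟩ := nu_form hD ν hdiamond
  refine ⟨c, ?_, ?_⟩
  · rw [ha0', hc, lead0]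
    ring
  · rw [haD', ← hshν, hc, map_mul, algHom_C, algebraMap_eq, shift_prodsq_Ico'', zero_add,
      sub_add_cancel, leadD]
    ring

end Summit.AtomisticToContinuum.FouriersLaw.Theorems.OddChargeAlgebra

end
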